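import Literature.Analysis.FluidPDE.RusinSverakWeakStrongLeaves
import Literature.Analysis.FluidPDE.JiaSverak2013AprioriEstimateProofs
import HarnessLib

/-!
# Rusin–Šverák's weak-limit blow-up (proof of Cor. 4.3, sentences 2–4) over the four live
leaves of its cone — review of the decomposition (D-0026)

Analysis/FluidPDE proof file (theorems only: no definition, no named fact) recording the outcome
of the review, 2026-08-15, of the decomposition child
`Literature.Analysis.FluidPDE.rusin_sverak_weak_limit_blowup` (`RusinSverakCompactnessProofs.lean`)
of the named fact `Literature.Analysis.FluidPDE.rusin_sverak_minimal_data_compact`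
(`RusinSverakCompactness.lean`; W. Rusin, V. Šverák, *Minimal initial data for potential
Navier–Stokes singularities*, J. Funct. Anal. 260 (2011) 879–891 = arXiv:0911.0500, Cor. 4.3,
second clause), whose prove seat had triaged the child XL and parked twice on the interior node
`rusin_sverak_weak_limit_of_singular_points` (**C**, Cor. 4.2).

## Source check (arXiv:0911.0500, read for this review)

p. 8, proof of Cor. 4.3: "Let `u₀^k ∈ Ḣ^{1/2}` be a sequence of initial data with `T_max(u₀^k)`
finite and `‖u₀^k‖ → ρ_max`. Find `λ_k > 0` and `x₀^k` so that the functions given by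
`v^k(x) = λ_k u₀^k(λ_k x − x₀^k)` develop their first singularity at time `t = 1` and that
`(x,t) = (0,1)` is a singular point of `v^k`. We can assume that the functions `v₀^k(x) = v^k(x,0)`
converge weakly in `Ḣ^{1/2}` to `v₀ ∈ Ḣ^{1/2}`. By Corollary 4.2 we know that `T_max(v₀) ≤ 1`";
p. 8, Cor. 4.2: "Let `u₀^k, u₀, u^k` be as in the theorem [Thm. 4.2]. Assume that
`T_max(u₀^k) = T < +∞` for each `k` and that the singular points `z_k` of `u` at `t = T` (which
exist by Proposition 4.1) stay in a compact subset of `ℝ³ × {T}`. Then `T_max(u₀) ≤ T`. Proof.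
Apply the theorem, together with Lemma 4.1, Proposition 2.2 and Lemma 2.1"; pp. 6–7, the
paragraph after Thm. 4.1: "the only reason for `T_max(u₀) < ∞` can be a finite time singularity".
The child renders exactly sentences 2–4 of the proof of Cor. 4.3 (normalisation of the first
singular point to `(0, 1)`, weak `Ḣ^{1/2}` limits of subsequences, blow-up of every weak limit),
without the minimality `‖u₀^k‖ = ρ_max`, which these sentences do not use. It is **in the source,
not an open problem, not mis-stated**: the tree proves it from the two printed ingredients it
combines — **N** "finite `T_max` forces a singular point" (`rusin_sverak_singular_point_of_blowup`,
now a theorem, `rusin_sverak_singular_point_of_blowup_holds`) and **C** = Cor. 4.2 — together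
with the Sobolev embedding `Ḣ^{1/2} ⊂ L³` (a theorem):
`rusin_sverak_weak_limit_blowup_of_weak_limit_of_singular_points : C → child`
(`RusinSverakWeakStrongLeaves.lean`), and the parent from the child
(`rusin_sverak_minimal_data_compact_of_weak_limit_blowup`, steps 2, 4, 5 of the printed proof:
Banach–Alaoglu, minimality, Radon–Riesz, all proved in `RusinSverakCompactnessProofs.lean`).

## Outcome of the review

*No further split, no restatement, no merge, no new named fact.* The cut parent = (functional
analysis, proved) + child (the PDE content of p. 8) follows the printed proof; the child is
consumed or concluded in code by eight accepted files (`RusinSverakMinimalData`,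
`RusinSverakWeakStability`, `RusinSverakWeakStabilityProofs`, `RusinSverakCompactnessSixLeaves`,
`RusinSverakWeakLimitBlowupFiveLeaves`, `RusinSverakWeakLimitBlowupLeafAssembly`,
`RusinSverakWeakLimitBlowupSevenLeaves`, `RusinSverakWeakStrongLeaves`), so deleting the def and
folding it into the parent's proof would only rewrite accepted importers without removing any
obligation. What made the child look XL is **C**, and **C** is no longer a proof
obligation of its own: accepted glue reduces it, entirely through pre-existing named facts of the
Lemarié-Rieusset / Jia–Šverák / Kikuchi–Seregin theory of local Leray solutions, to printed
results each carrying its own locator and its own prove seat —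
`rusin_sverak_weak_limit_of_singular_points_of_five_leaves' : F2 → U → J2 → J8 → Lim → C`
(`RusinSverakWeakStrongLeaves.lean`, over `…_of_local_leray_theory : E → U → A → R → S → C`,
`RusinSverakLerayWeakStrong.lean` / `RusinSverakLeraySolutions.lean`, with **A**, **R**, Prop. 2.2,
Lemma 2.1, ε-regularity and the CKN inputs theorems of the tree). Of the five leaves **J2**
(`jia_sverak_2013_lemma_2`, Jia–Šverák 2013 Lemma 2 = Rusin–Šverák Lemma 4.1 in `L³` form) became
a theorem on 2026-08-15 (`jia_sverak_2013_lemma_2_holds`, `JiaSverak2013AprioriEstimateProofs.lean`).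
Hence the trust base of the child — and of **C**, of the parent, and of Cor. 4.3's first clause
`rusin_sverak_minimal_blowup` (`MildSolutions.lean`, ns.S14) — is **exactly four undischarged
named facts**, recorded below as checked implications:

1. **F2** `localEnergySolution_extension_of_memE2` — the extension step for local energy
   solutions with `E²` data (Seregin 2014, App. B §B.5; Lemarié-Rieusset 2016, Thm. 14.8, proof,
   Steps 1–3), `LocalEnergyExtension.lean`; in-tree reduced to unit-time existence for `E̊₃` data
   (`localEnergySolution_extension_of_memE2_of_unitExistence`); it supplies **E** for `L³` data
   through Kato's local stage (`leray_solution_exists_of_memLp_three_of_extension`);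
2. **U** `local_leray_weak_strong_uniqueness` — weak–strong uniqueness for local Leray solutions
   (Lemarié-Rieusset 2016, Thm. 14.7), `LocalLerayWeakStrong.lean` (its former child **U₁**
   `local_leray_difference_energy_estimate` is refuted, `not_local_leray_difference_energy_estimate`;
   **U** itself, over `E²` data, stands);
3. **J8** `jia_sverak_2013_lemma_8` — the uniform initial layer (Jia–Šverák 2013, Lemma 8;
   Lemarié-Rieusset 2016, Prop. 15.1), `JiaSverak2013Compactness.lean`;
4. **Lim** `localLeray_limit_isLocalLeraySolution` — the limit of local Leray solutions is a local
   Leray solution with the weak-limit datum (Jia–Šverák 2013, proof of Thm. 1; Seregin 2014,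
   App. B §B.4), `LocalLerayLimitingProcedure.lean`.

Guidance for the child's prove seat (inline mode): do not park on **C** again — it is an interior
node whose own discharge is the same one-liner over the same four leaves, so nothing can land for
it before they do; claim (`ledger fact claim`) whichever of the four leaves is free, or park
`blocked-on` one of *them*. The discharges are the one-liners

    theorem rusin_sverak_weak_limit_blowup_holds : rusin_sverak_weak_limit_blowup :=
      rusin_sverak_weak_limit_blowup_of_four_leaves F2_holds U_holds J8_holds Lim_holds

(and likewise `rusin_sverak_weak_limit_of_singular_points_holds`,
`rusin_sverak_minimal_data_compact_holds`, `rusin_sverak_minimal_blowup_holds` through the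
theorems below), to be placed in a sibling `…Holds.lean` importing this file and the four leaf
discharges — not appended to `RusinSverakCompactnessProofs.lean`, which every file of this cone
imports (an import of the leaves there would close a cycle).

## Main results (all proved; axioms `propext`, `Classical.choice`, `Quot.sound`)

* `rusin_sverak_weak_limit_of_singular_points_of_four_leaves : F2 → U → J8 → Lim → C`;
* `rusin_sverak_weak_limit_blowup_of_four_leaves : F2 → U → J8 → Lim → rusin_sverak_weak_limit_blowup`;
* `rusin_sverak_minimal_data_compact_of_four_leaves`, `rusin_sverak_minimal_blowup_of_four_leaves`
  (Cor. 4.3, both clauses);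
* `leray_theory_inputs_of_four_leaves : F2 → U → J8 → Lim → E ∧ W ∧ R ∧ S`.

## Mathlib / tree search

Tree (all used): `rusin_sverak_weak_limit_of_singular_points_of_five_leaves'`,
`leray_theory_inputs_of_five_leaves'`, `rusin_sverak_weak_limit_blowup_of_weak_limit_of_singular_points`,
`rusin_sverak_minimal_data_compact_of_weak_limit_of_singular_points`,
`rusin_sverak_minimal_blowup_of_weak_limit_of_singular_points` (`RusinSverakWeakStrongLeaves.lean`),
`jia_sverak_2013_lemma_2_holds` (`JiaSverak2013AprioriEstimateProofs.lean`). `lean search`: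
nothing named `rusin_sverak_*_of_four_leaves`; no `_holds` for F2, U, J8, Lim (2026-08-15).

## References

* W. Rusin, V. Šverák, J. Funct. Anal. 260 (2011) 879–891 = arXiv:0911.0500: §4 pp. 6–7 (Leray
  solutions, Thm. 4.1 and the paragraph following it, Prop. 4.1, Lemma 4.1), Thm. 4.2, Cor. 4.2,
  Cor. 4.3 and their proofs (p. 8). [RusinSverak2011]
* H. Jia, V. Šverák, SIAM J. Math. Anal. 45 (2013) 1448–1459 = arXiv:1201.1592: Lemma 2, Lemma 8,
  proof of Thm. 1. [JiaSverak2013]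
* P. G. Lemarié-Rieusset, *The Navier–Stokes Problem in the 21st Century*, CRC Press 2016,
  doi:10.1201/b19556: Thm. 14.7, Thm. 14.8 and its proof, Prop. 15.1, Thm. 15.1. [LemarieRieusset2016]
* G. Seregin, *Lecture Notes on Regularity Theory for the Navier–Stokes Equations*, World
  Scientific 2014, App. B §B.4–§B.5. [Seregin2014Notes]
-/

noncomputable section

namespace Literature.Analysis.FluidPDE

/-- **Rusin–Šverák, Cor. 4.2 (`rusin_sverak_weak_limit_of_singular_points`), over the four live
leaves of its cone**: the extension step **F2**, weak–strong uniqueness **U**, Jia–Šverák's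
Lemma 8 **J8** and the identification of the limit **Lim** — the accepted five-leaves glue
`rusin_sverak_weak_limit_of_singular_points_of_five_leaves'` with Jia–Šverák's Lemma 2 supplied by
its discharge `jia_sverak_2013_lemma_2_holds`.
[cite: RusinSverak2011, Cor. 4.2 and its proof (arXiv:0911.0500 p. 8), with §4 p. 6 and Thm. 4.1] -/
theorem rusin_sverak_weak_limit_of_singular_points_of_four_leaves
    (hF2 : localEnergySolution_extension_of_memE2) (hU : local_leray_weak_strong_uniqueness)
    (hJ8 : jia_sverak_2013_lemma_8) (hLim : localLeray_limit_isLocalLeraySolution) :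
    rusin_sverak_weak_limit_of_singular_points :=
  rusin_sverak_weak_limit_of_singular_points_of_five_leaves' hF2 hU jia_sverak_2013_lemma_2_holds
    hJ8 hLim

/-- The four Leray-theory inputs **E** (`leray_solution_exists_of_memLp_three`), **W**
(`leray_solution_ae_eq_kato`), **R** (`kato_solution_le_div_sqrt`), **S**
(`rusin_sverak_leray_singular_points_stable`) of the accepted glue
`rusin_sverak_weak_limit_of_singular_points_of_leray_theory`, jointly, over the same four live
leaves (`leray_theory_inputs_of_five_leaves'` with `jia_sverak_2013_lemma_2_holds`).
[cite: RusinSverak2011, §4 p. 6, Thm. 4.1, Thm. 4.2 with Lemma 2.1 (arXiv:0911.0500 pp. 6–8)] -/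
theorem leray_theory_inputs_of_four_leaves
    (hF2 : localEnergySolution_extension_of_memE2) (hU : local_leray_weak_strong_uniqueness)
    (hJ8 : jia_sverak_2013_lemma_8) (hLim : localLeray_limit_isLocalLeraySolution) :
    leray_solution_exists_of_memLp_three ∧ leray_solution_ae_eq_kato ∧
      kato_solution_le_div_sqrt ∧ rusin_sverak_leray_singular_points_stable :=
  leray_theory_inputs_of_five_leaves' hF2 hU jia_sverak_2013_lemma_2_holds hJ8 hLim

/-- **Rusin–Šverák's weak-limit blow-up (`rusin_sverak_weak_limit_blowup`, proof of Cor. 4.3,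
sentences 2–4) over the four live leaves F2, U, J8, Lim** — the complete trust base of the
decomposition child after the discharge of "finite `T_max` forces a singular point" (**N**), of
the Sobolev embedding and of Jia–Šverák's Lemma 2: Cor. 4.2 over the four leaves, then
`rusin_sverak_weak_limit_blowup_of_weak_limit_of_singular_points`. The discharge
`rusin_sverak_weak_limit_blowup_holds` is this theorem applied to the four leaf discharges once
they exist. [cite: RusinSverak2011, proof of Cor. 4.3, sentences 2–4 (arXiv:0911.0500 p. 8), with Cor. 4.2] -/
theorem rusin_sverak_weak_limit_blowup_of_four_leaves
    (hF2 : localEnergySolution_extension_of_memE2) (hU : local_leray_weak_strong_uniqueness)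
    (hJ8 : jia_sverak_2013_lemma_8) (hLim : localLeray_limit_isLocalLeraySolution) :
    rusin_sverak_weak_limit_blowup :=
  rusin_sverak_weak_limit_blowup_of_weak_limit_of_singular_points
    (rusin_sverak_weak_limit_of_singular_points_of_four_leaves hF2 hU hJ8 hLim)

/-- **Rusin–Šverák, Cor. 4.3, second clause (`rusin_sverak_minimal_data_compact`: the set of
`Ḣ^{1/2}`-minimal blow-up data is compact modulo scalings and translations) over the four live
leaves F2, U, J8, Lim** — the parent of the reviewed child, through
`rusin_sverak_minimal_data_compact_of_weak_limit_of_singular_points`.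
[cite: RusinSverak2011, Cor. 4.3, second clause, and its proof (arXiv:0911.0500 p. 8)] -/
theorem rusin_sverak_minimal_data_compact_of_four_leaves
    (hF2 : localEnergySolution_extension_of_memE2) (hU : local_leray_weak_strong_uniqueness)
    (hJ8 : jia_sverak_2013_lemma_8) (hLim : localLeray_limit_isLocalLeraySolution) :
    rusin_sverak_minimal_data_compact :=
  rusin_sverak_minimal_data_compact_of_weak_limit_of_singular_points
    (rusin_sverak_weak_limit_of_singular_points_of_four_leaves hF2 hU hJ8 hLim)

/-- **Rusin–Šverák, Cor. 4.3, first clause (`rusin_sverak_minimal_blowup`, ns.S14: if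
`ρ_max < ∞`, some weakly divergence-free `Ḣ^{1/2}` datum of norm exactly `ρ_max` has no global
Kato solution) over the four live leaves F2, U, J8, Lim**, through
`rusin_sverak_minimal_blowup_of_weak_limit_of_singular_points`.
[cite: RusinSverak2011, Cor. 4.3, first clause, and its proof (arXiv:0911.0500 p. 8)] -/
theorem rusin_sverak_minimal_blowup_of_four_leaves
    (hF2 : localEnergySolution_extension_of_memE2) (hU : local_leray_weak_strong_uniqueness)
    (hJ8 : jia_sverak_2013_lemma_8) (hLim : localLeray_limit_isLocalLeraySolution) :
    rusin_sverak_minimal_blowup :=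
  rusin_sverak_minimal_blowup_of_weak_limit_of_singular_points
    (rusin_sverak_weak_limit_of_singular_points_of_four_leaves hF2 hU hJ8 hLim)

end Literature.Analysis.FluidPDE

end
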